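import Summits.PneNP.PneNP.Theorems.SfmBlMachineHatPairs
import Summits.PneNP.PneNP.Theorems.SfmBlMachineSpotsSpec
import Summits.PneNP.PneNP.Theorems.SfmBlMachineDictGraph

/-!
# Line «sfm-bl», MACHINE LAYER M4-SEM (part 3): the machine's connectivity test IS `IsConnectedPair` (stmt-PneNP-20523)

FRONTIER F-N1c; nothing here bears on P vs NP.

In the generic dictionary setting of `SfmBlMachineHatPairs`:
* `exists_walk_of_mem_walksU` — every record of M2a's enumeration `walksU es ℓ` is the support of a genuine walk of
  `pieceGraph es` (all of whose vertices are pieces of `es`);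
* `pieceGraph_legsIn_adj_iff` — adjacency of `ι₁ i`, `ι₂ k` in the piece graph of the inside legs of a pair
  ⟺ `∃ e, srcE e = i ∧ dstE e = k` (no same-side adjacency is prover-1's `not_pieceGraph_adj_of_tag_eq`, D1b);
* **`connTest_iff`** — `connTest cap xs (w₁, w₂) = true ⟺ SfmBl.IsConnectedPair (∃ e, srcE e = · ∧ dstE e = ·)
  (toW₁ w₁) (toW₂ w₂)` when the walk cap is not binding (through p3's `isConnectedPair_iff_connected_labels`,
  prover-1's `exists_mem_walksU_exact` / `walksC_eq_walksU`, and Mathlib's `Walk.connected_induce_support`).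
-/

set_option linter.dupNamespace false -- `Summit.PneNP.PneNP.…`: summit = sub-problem name (D-0017 single-conjunct layout)

namespace Summit.PneNP.PneNP.Theorems.SfmBlMachine

open Finset
open Summit.PneNP.PneNP.Theorems.SfmBl (IsConnectedPair isConnectedPair_iff_connected_labels)

/-! ## Walk records are walks -/

/-- **Every record of M2a's enumeration is a genuine walk of the piece graph**, with all its vertices pieces. -/
theorem exists_walk_of_mem_walksU (es : List PLeg) : ∀ (ℓ : ℕ) (w : WalkRec), w ∈ walksU es ℓ →
    ∃ (P : Lab) (p : (pieceGraph es).Walk P w.1), p.support = w.2 ∧ p.length = ℓ ∧ ∀ Q ∈ w.2, Q ∈ pieces es := by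
  intro ℓ
  induction ℓ with
  | zero =>
    intro w hw
    unfold walksU walks0 at hw
    obtain ⟨P, hP, rfl⟩ := List.mem_map.1 hw
    exact ⟨P, SimpleGraph.Walk.nil, rfl, rfl, fun Q hQ => by rw [List.mem_singleton] at hQ; rw [hQ]; exact hP⟩
  | succ ℓ ih =>
    intro w hw
    rw [walksU] at hw
    unfold extend at hw
    obtain ⟨l, hl, hwl⟩ := List.mem_flatten.1 hw
    obtain ⟨w₀, hw₀, rfl⟩ := List.mem_map.1 hl
    obtain ⟨Q, hQ, rfl⟩ := List.mem_map.1 hwl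
    obtain ⟨P, p, hsupp, hlen, hpieces⟩ := ih w₀ hw₀
    have hne : w₀.1 ≠ Q := by
      unfold nbrs at hQ
      simp only [List.mem_append, List.mem_map, List.mem_filter, decide_eq_true_eq] at hQ
      rcases hQ with ⟨x, ⟨_, hx⟩, rfl⟩ | ⟨x, ⟨_, hx⟩, rfl⟩
      · rw [← hx]; exact labL_ne_labR x x
      · rw [← hx]; exact (labL_ne_labR x x).symm
    have hadj : (pieceGraph es).Adj w₀.1 Q := (pieceGraph_adj es _ _).2 ⟨hne, hQ⟩
    refine ⟨P, p.concat hadj, ?_, ?_, fun Q' hQ' => ?_⟩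
    · rw [SimpleGraph.Walk.support_concat, hsupp]
    · rw [SimpleGraph.Walk.length_concat, hlen]
    · simp only [List.mem_append, List.mem_singleton] at hQ'
      rcases hQ' with h | rfl
      · exact hpieces Q' h
      · exact mem_pieces_of_mem_nbrs es hQ

/-- The pieces of the inside legs lie in the pair. -/
theorem mem_append_of_mem_pieces_legsIn (xs : List PLeg) (W : Cand) {P : Lab} (h : P ∈ pieces (legsIn xs W)) :
    P ∈ W.1 ++ W.2 := by
  unfold pieces legsIn at h
  rw [List.mem_dedup, List.mem_append, List.mem_map, List.mem_map] at h
  simp only [List.mem_filter, Bool.and_eq_true, decide_eq_true_eq] at h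
  rw [List.mem_append]
  rcases h with ⟨x, ⟨_, hx, _⟩, rfl⟩ | ⟨x, ⟨_, _, hx⟩, rfl⟩
  · exact Or.inl hx
  · exact Or.inr hx

section Conn

variable {α β E : Type} [Fintype E] [DecidableEq α] [DecidableEq β]
  {ι₁ : α → Lab} {ι₂ : β → Lab} {srcE : E → α} {dstE : E → β} {φ : E → PLeg} {xs : List PLeg}

/-- Adjacency of a left and a right label in the piece graph of the inside legs of `(w₁, w₂)`. -/
theorem pieceGraph_legsIn_adj_iff (hmem : ∀ x, x ∈ xs ↔ ∃ e, φ e = x) (hL : ∀ e, labL (φ e) = ι₁ (srcE e))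
    (hR : ∀ e, labR (φ e) = ι₂ (dstE e)) (hι₁ : Function.Injective ι₁) (hι₂ : Function.Injective ι₂)
    (h01 : ∀ a, (ι₁ a).1 = 0) (h11 : ∀ b, (ι₂ b).1 = 1) (W : Cand) {i : α} {k : β}
    (hi : i ∈ toW₁ ι₁ srcE W.1) (hk : k ∈ toW₂ ι₂ dstE W.2) :
    (∃ e, srcE e = i ∧ dstE e = k) ↔ (pieceGraph (legsIn xs W)).Adj (ι₁ i) (ι₂ k) := by
  have hne : ι₁ i ≠ ι₂ k := fun h => by have := congrArg Prod.fst h; rw [h01, h11] at this; exact absurd this (by norm_num)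
  rw [pieceGraph_adj]
  unfold nbrs
  simp only [List.mem_append, List.mem_map, List.mem_filter, decide_eq_true_eq]
  simp only [toW₁, toW₂, mem_filter] at hi hk
  constructor
  · rintro ⟨e, rfl, rfl⟩
    refine ⟨hne, Or.inl ⟨φ e, ⟨?_, hL e⟩, hR e⟩⟩
    rw [mem_legsIn_iff hmem hL hR]
    exact ⟨e, ⟨by simp only [toW₁, mem_filter]; exact hi, by simp only [toW₂, mem_filter]; exact hk⟩, rfl⟩
  · rintro ⟨_, ⟨x, ⟨hx, hxi⟩, hxk⟩ | ⟨x, ⟨_, hxi⟩, _⟩⟩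
    · obtain ⟨e, _, rfl⟩ := (mem_legsIn_iff hmem hL hR W x).1 hx
      rw [hL] at hxi; rw [hR] at hxk
      exact ⟨e, hι₁ hxi, hι₂ hxk⟩
    · exfalso
      have := congrArg Prod.fst hxi
      rw [h01] at this
      simp [labR] at this

/-- **THE MACHINE'S CONNECTIVITY TEST IS `IsConnectedPair`** (cap not binding). -/
theorem connTest_iff (hmem : ∀ x, x ∈ xs ↔ ∃ e, φ e = x) (hL : ∀ e, labL (φ e) = ι₁ (srcE e))
    (hR : ∀ e, labR (φ e) = ι₂ (dstE e)) (hι₁ : Function.Injective ι₁) (hι₂ : Function.Injective ι₂)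
    (h01 : ∀ a, (ι₁ a).1 = 0) (h11 : ∀ b, (ι₂ b).1 = 1) {cap : ℕ} {w₁ w₂ : List Lab}
    (hw₁ : List.Sublist w₁ (lpieces xs)) (hw₂ : List.Sublist w₂ (rpieces xs))
    (hcap : ∀ k, k ≤ 2 * ((w₁ ++ w₂).length - 1) → (walksU (legsIn xs (w₁, w₂)) k).length ≤ cap) :
    connTest cap xs (w₁, w₂) = true ↔
      IsConnectedPair (fun i k => ∃ e, srcE e = i ∧ dstE e = k) (toW₁ ι₁ srcE w₁) (toW₂ ι₂ dstE w₂) := by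
  classical
  set es := legsIn xs (w₁, w₂) with hes
  set S := w₁ ++ w₂ with hS
  -- the label set of the pair is `S`
  have hlab : (toW₁ ι₁ srcE w₁).image ι₁ ∪ (toW₂ ι₂ dstE w₂).image ι₂ = S.toFinset := by
    rw [image_toW₁ hmem hL hw₁, image_toW₂ hmem hR hw₂, hS, List.toFinset_append]
  have hSnd : S.Nodup := by
    refine List.Nodup.append (hw₁.nodup (List.nodup_dedup _)) (hw₂.nodup (List.nodup_dedup _)) fun P h1 h2 => ?_
    obtain ⟨e, rfl⟩ := (mem_lpieces_iff hmem hL P).1 (hw₁.subset h1)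
    obtain ⟨e', he'⟩ := (mem_rpieces_iff hmem hR _).1 (hw₂.subset h2)
    have := congrArg Prod.fst he'
    rw [h01, h11] at this
    exact absurd this (by norm_num)
  -- transfer to the piece graph of the inside legs
  rw [isConnectedPair_iff_connected_labels (fun i k => ∃ e, srcE e = i ∧ dstE e = k) (pieceGraph es) ι₁ ι₂
    (toW₁ ι₁ srcE w₁) (toW₂ ι₂ dstE w₂) (hι₁.injOn) (hι₂.injOn)
    (fun i _ k _ h => by have := congrArg Prod.fst h; rw [h01, h11] at this; exact absurd this (by norm_num))
    (fun i _ i' _ => not_pieceGraph_adj_of_tag_eq es (by rw [h01, h01]))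
    (fun k _ k' _ => not_pieceGraph_adj_of_tag_eq es (by rw [h11, h11]))
    (fun i hi k hk => pieceGraph_legsIn_adj_iff hmem hL hR hι₁ hι₂ h01 h11 (w₁, w₂) hi hk), hlab]
  have hcapU : walksC es cap (List.replicate (2 * (S.length - 1)) ()) = walksU es (2 * (S.length - 1)) := by
    rw [walksC_eq_walksU es cap _ (fun k hk => hcap k (by simpa using hk)), List.length_replicate]
  unfold connTest
  rw [Bool.or_eq_true, decide_eq_true_eq, List.any_eq_true]
  simp only [← hS, ← hes]
  constructor
  · rintro (h1 | ⟨w, hw, hall⟩)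
    · -- a single piece
      obtain ⟨P, hP⟩ : ∃ P, S = [P] := List.length_eq_one_iff.1 h1
      have hset : ((S.toFinset : Finset Lab) : Set Lab) = {P} := by rw [hP]; simp
      rw [hset, SimpleGraph.induce_singleton_eq_top]
      haveI : Nonempty (({P} : Set Lab) : Type) := ⟨⟨P, rfl⟩⟩
      exact SimpleGraph.connected_top
    · -- a covering walk
      rw [hcapU] at hw
      obtain ⟨P, p, hsupp, _, hpieces⟩ := exists_walk_of_mem_walksU es _ w hw
      rw [List.all_eq_true] at hall
      have hset : ((S.toFinset : Finset Lab) : Set Lab) = {v | v ∈ p.support} := by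
        ext v
        rw [Finset.mem_coe, List.mem_toFinset, Set.mem_setOf_eq, hsupp]
        exact ⟨fun hv => by simpa using hall v hv, fun hv => mem_append_of_mem_pieces_legsIn xs (w₁, w₂) (hpieces v hv)⟩
      rw [hset]
      exact p.connected_induce_support
  · intro hconn
    by_cases h1 : S.length = 1
    · exact Or.inl h1
    right
    have hne : S ≠ [] := by
      intro h0
      have := hconn.nonempty
      rw [h0] at this
      obtain ⟨⟨v, hv⟩⟩ := this
      simp at hv
    have h2 : 2 ≤ S.length := by
      have := List.length_pos_of_ne_nil hne; omega
    -- every piece of `S` has a neighbour inside, hence is a piece of the inside legs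
    have hSp : ∀ P ∈ S.toFinset, P ∈ pieces es := by
      intro P hP
      have hP' : P ∈ ((S.toFinset : Finset Lab) : Set Lab) := hP
      obtain ⟨Q, hQ, hPQ⟩ : ∃ Q ∈ S, Q ≠ P := by
        by_contra hall
        push Not at hall
        have : S.length ≤ 1 := by
          rw [← List.toFinset_card_of_nodup hSnd]
          exact Finset.card_le_one.2 fun a ha b hb => by
            rw [List.mem_toFinset] at ha hb; rw [hall a ha, hall b hb]
        omega
      have hQ' : Q ∈ ((S.toFinset : Finset Lab) : Set Lab) := by simpa using hQ
      obtain ⟨p⟩ := hconn.preconnected ⟨P, hP'⟩ ⟨Q, hQ'⟩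
      have hnil : ¬ p.Nil := SimpleGraph.Walk.not_nil_of_ne (fun h => hPQ (congrArg Subtype.val h).symm)
      have hadj := SimpleGraph.Walk.adj_snd hnil
      rw [SimpleGraph.induce_adj] at hadj
      have := ((pieceGraph_adj es _ _).1 hadj).2
      exact (mem_nbrs_comm es _ _).1 this |> mem_pieces_of_mem_nbrs es
    obtain ⟨w, hw, hwS⟩ := exists_mem_walksU_exact es S.toFinset hSp (s := S.length - 1) (t := S.length - 1)
      (by omega) le_rfl (by rw [List.toFinset_card_of_nodup hSnd]; omega) hconn
    refine ⟨w, by rw [hcapU]; exact hw, ?_⟩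
    rw [List.all_eq_true]
    intro P hP
    have : P ∈ w.2.toFinset := by rw [hwS]; exact List.mem_toFinset.2 hP
    simpa using this

end Conn

end Summit.PneNP.PneNP.Theorems.SfmBlMachine
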